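import Mathlib
import HarnessLib
import Summits.Ventures.LatticeQCDFlow.Scaling.ChiSqContraction
import Summits.Ventures.LatticeQCDFlow.Scaling.TiltedMarginals
import Summits.Ventures.LatticeQCDFlow.Scaling.TiltedProtocolMass

/-!
# TiltedProtocolRecursion — the two layer-dependent inequalities of the tilted (Feynman–Kac)
# recursion: a `χ²`-contracting layer contracts `massDev` at any mass, and the tilt-and-change-of-
# reference bound (the kernel-side toolkit for the general-layer ESS floor and the work-MGF envelope)

HONEST FRAMING: exact (Metropolis-corrected) sampling algorithms for lattice gauge theory;
figures of merit are autocorrelation/cost numbers at stated couplings and volumes; no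
continuum-physics claim.

Venture `LatticeQCDFlow` (cell pub-lqcd), topic `Scaling`; FANOUT row 19 (`su2-snf`, GEN-6).
OUR WORK (elementary finite sums), nothing here is cited as a fact.  Vocabulary:
`Scaling/TiltedMarginals` (`tiltEvolve`, `massDev`, the tilted lag bound, this seat) and the
`χ²`-contraction property `ChiSqContracts K π ρ` of `Scaling/ChiSqContraction` (row 19 GEN-5).

* the tilted lag bound `abs_sum_mul_sub_mass_mul_le` (`|ν[g] − |ν|·π[g]| ≤ √Var_π(g) · massDev π ν`)
  now lives in `Scaling/TiltedProtocolMass` (GEN-10) and is imported;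
* `massDev_stepLaw_le` — a layer that `χ²`-contracts towards `π` with `ρ` contracts `massDev π` by
  `ρ` (any non-zero mass: `ν = |ν|·(ν/|ν|)` and homogeneity);
* **`massDev_tilt_le`** — TILT AND CHANGE OF REFERENCE: if `g²·π ≤ C²·π'` pointwise then
  `massDev π' (g·ν) ≤ C·massDev π ν + |ν|·π[g]·√χ²(T_g π ‖ π') + √Var_π(g)·massDev π ν`,
  `T_g π = g·π/π[g]` the `g`-tilt of `π` (Minkowski in `L²(1/π')` on
  `g·ν − ν[g]·π' = g·(ν − |ν|π) + |ν|·(g·π − π[g]·π') + (|ν|·π[g] − ν[g])·π'`).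

NOT CLAIMED: anything model-specific (Gibbs laws, grids: `Scaling/TiltedLinearProtocol`,
`Scaling/TiltedProtocolMoments`).
-/

namespace Summit.Ventures.LatticeQCDFlow.Scaling

open Finset
open Literature.Probability.MarkovChains (IsRowStochastic stepLaw)
open Literature.Probability.ImportanceSampling (chiSqDiv chiSqDiv_def chiSqDiv_eq_sum_sq_div)
open Summit.Ventures.LatticeQCDFlow.Exactness
open Summit.Ventures.LatticeQCDFlow.Theory2

variable {X : Type*} [Fintype X]

/-- **A `χ²`-contracting layer contracts `massDev` by the same factor, at any mass.**
(`ν = |ν|·(ν/|ν|)`, homogeneity, and `ChiSqContracts` on the unit-mass part; `|ν| ≠ 0`.) -/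
theorem massDev_stepLaw_le {K : X → X → ℝ} {π ν : X → ℝ} {ρ : ℝ} (hK : ChiSqContracts K π ρ)
    (hKrow : ∀ x, ∑ y, K x y = 1) (hρ : 0 ≤ ρ) (hm : ∑ x, ν x ≠ 0) :
    massDev π (stepLaw K ν) ≤ ρ * massDev π ν := by
  set m := ∑ x, ν x with hm'
  set μ : X → ℝ := fun x => ν x / m with hμ
  have hμ1 : ∑ x, μ x = 1 := by
    rw [hμ]; simp only; rw [← sum_div, ← hm', div_self hm]
  have hν : ν = fun x => m * μ x := by
    funext x; rw [hμ]; simp only; field_simp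
  have hKμ1 : ∑ y, stepLaw K μ y = 1 := by rw [sum_stepLaw_of_rowsum hKrow, hμ1]
  rw [hν, stepLaw_const_mul, massDev_smul π hKμ1 m, massDev_smul π hμ1 m]
  have hc := hK μ hμ1
  calc |m| * Real.sqrt (chiSqDiv (stepLaw K μ) π)
      ≤ |m| * Real.sqrt (ρ ^ 2 * chiSqDiv μ π) :=
        mul_le_mul_of_nonneg_left (Real.sqrt_le_sqrt hc) (abs_nonneg _)
    _ = ρ * (|m| * Real.sqrt (chiSqDiv μ π)) := by
        rw [Real.sqrt_mul (sq_nonneg ρ), Real.sqrt_sq hρ]; ring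

/-- **TILT AND CHANGE OF REFERENCE LAW.**  For positive probability vectors `π, π'`, a weight `g`
with `π[g] > 0` and `C ≥ 0` with `g(x)²·π(x) ≤ C²·π'(x)` for all `x`: for every `ν`,
`massDev π' (g·ν) ≤ C·massDev π ν + |Σν|·π[g]·√χ²(T_g π ‖ π') + √Var_π(g)·massDev π ν`
(`T_g π = g·π/π[g]`; Minkowski in `L²(1/π')` on the three-term split, the last term by the tilted
lag bound). -/
theorem massDev_tilt_le {π π' ν g : X → ℝ} (hπ : ∀ x, 0 < π x) (hπ1 : ∑ x, π x = 1)
    (hπ' : ∀ x, 0 < π' x) (hπ'1 : ∑ x, π' x = 1) (hg : 0 < ∑ x, π x * g x)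
    {C : ℝ} (hC0 : 0 ≤ C) (hC : ∀ x, g x ^ 2 * π x ≤ C ^ 2 * π' x) :
    massDev π' (fun x => g x * ν x)
      ≤ C * massDev π ν
        + |∑ x, ν x| * (∑ x, π x * g x)
            * Real.sqrt (chiSqDiv (fun x => π x * g x / ∑ y, π y * g y) π')
        + Real.sqrt (varLaw π g) * massDev π ν := by
  set m := ∑ x, ν x with hm
  set gbar := ∑ x, π x * g x with hgbar
  set m' := ∑ x, g x * ν x with hm'
  -- the three pieces
  set a : X → ℝ := fun x => g x * (ν x - m * π x) with ha
  set b : X → ℝ := fun x => m * (g x * π x - gbar * π' x) with hb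
  set e : X → ℝ := fun x => (m * gbar - m') * π' x with he
  have hsplit : ∀ x, g x * ν x - m' * π' x = (a x + b x) + e x := by
    intro x; simp only [ha, hb, he]; ring
  have hdev : massDev π' (fun x => g x * ν x)
      = Real.sqrt (∑ x, ((a x + b x) + e x) ^ 2 / π' x) := by
    unfold massDev
    rw [← hm']
    congr 1
    exact sum_congr rfl fun x _ => by rw [hsplit]
  -- Minkowski twice
  have hmink := (sqrt_sum_add_sq_div_le hπ' (fun x => a x + b x) e).trans
    (add_le_add (sqrt_sum_add_sq_div_le hπ' a b) le_rfl)
  -- term a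
  have hA : Real.sqrt (∑ x, a x ^ 2 / π' x) ≤ C * massDev π ν := by
    have hle : ∑ x, a x ^ 2 / π' x ≤ C ^ 2 * ∑ x, (ν x - m * π x) ^ 2 / π x := by
      rw [mul_sum]
      refine sum_le_sum fun x _ => ?_
      simp only [ha]
      rw [mul_pow, div_le_iff₀ (hπ' x)]
      have h1 : C ^ 2 * ((ν x - m * π x) ^ 2 / π x) * π' x
          = (C ^ 2 * π' x) * (ν x - m * π x) ^ 2 / π x := by ring
      rw [h1, le_div_iff₀ (hπ x)]
      have h2 : g x ^ 2 * (ν x - m * π x) ^ 2 * π x = (g x ^ 2 * π x) * (ν x - m * π x) ^ 2 := by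
        ring
      rw [h2]
      exact mul_le_mul_of_nonneg_right (hC x) (sq_nonneg _)
    calc Real.sqrt (∑ x, a x ^ 2 / π' x)
        ≤ Real.sqrt (C ^ 2 * ∑ x, (ν x - m * π x) ^ 2 / π x) := Real.sqrt_le_sqrt hle
      _ = C * massDev π ν := by
          rw [Real.sqrt_mul (sq_nonneg C), Real.sqrt_sq hC0]
          rfl
  -- term b
  have hB : Real.sqrt (∑ x, b x ^ 2 / π' x)
      = |m| * gbar * Real.sqrt (chiSqDiv (fun x => π x * g x / gbar) π') := by
    rw [chiSqDiv_eq_sum_sq_div]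
    have hle : ∑ x, b x ^ 2 / π' x
        = (m * gbar) ^ 2 * ∑ x, (π x * g x / gbar - π' x) ^ 2 / π' x := by
      rw [mul_sum]
      refine sum_congr rfl fun x _ => ?_
      simp only [hb]
      have : m * (g x * π x - gbar * π' x) = (m * gbar) * (π x * g x / gbar - π' x) := by
        field_simp [hg.ne']
      rw [this, mul_pow]
      ring
    rw [hle, Real.sqrt_mul (sq_nonneg _), Real.sqrt_sq_eq_abs, abs_mul, abs_of_pos hg]
  -- term e
  have hE : Real.sqrt (∑ x, e x ^ 2 / π' x) ≤ Real.sqrt (varLaw π g) * massDev π ν := by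
    have hsum : ∑ x, e x ^ 2 / π' x = (m * gbar - m') ^ 2 := by
      have : ∀ x, e x ^ 2 / π' x = (m * gbar - m') ^ 2 * π' x := by
        intro x; simp only [he]
        field_simp [(hπ' x).ne']
      simp_rw [this]
      rw [← mul_sum, hπ'1, mul_one]
    rw [hsum, Real.sqrt_sq_eq_abs, abs_sub_comm]
    exact abs_sum_mul_sub_mass_mul_le hπ hπ1 ν g
  rw [hdev]
  linarith [hmink, hA, hB, hE]

end Summit.Ventures.LatticeQCDFlow.Scaling
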